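import Literature.Computability.AlgebraicComplexity.CwSquareGenericPhi
import HarnessLib

/-!
# The pivot tables of the uniform `p = 1` flattening of `T_{cw,q}^{⊠2}` and their verification at `q = 9`

Topic: `Literature/Computability/AlgebraicComplexity`. Step F2 of the general case `q ≥ 5` of the
square part of Conner–Gesmundo–Landsberg–Ventura 2022, Thm. 1.2 (see `CwSquareGenericPhi.lean` for the
restriction `φ` and the entry function `CwSqGen.kgen`). The flattening matrix `K = K_φ(T_{cw,q}^{⊠2})`
(`p = 1`, size `3(q+1)² × 3(q+1)²`) is a PERMUTED TRIANGULAR MATRIX OF RANK `2(q+2)²`, uniformly in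
`q ≥ 5`: iterated removal of rows, resp. columns, with a single non-zero entry ("peeling") exhausts a
`2(q+2)² × 2(q+2)²` minor in `14` rounds, and which rows/columns are removed in which round, and
with which partner, depends only on the SHAPE of the row `(t, (c₁, c₂))` — the classes of `c₁, c₂` in
`{0, 1, 2, 3, 4, 5, generic (≥ 6)}` and, for two generic indices, whether they are equal — the
partner being obtained by "plumbing" (each partner index is a constant `≤ 5` or a copy of `c₁` or
`c₂`). This file records the two shape tables (found by running the peeling at `q = 11` outside
Lean) and VERIFIES them at `q = 9` inside the kernel:

* `CwSqGen.clsNat`, `CwSqGen.eqFlag`, `CwSqGen.plumbApply`, `CwSqGen.rowTab`, `CwSqGen.colTab`,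
  `CwSqGen.rowInfo`, `CwSqGen.colInfo` — shapes, tables, and the induced pivot data at every `q`.
* `CwSqGen.GoodAt q` — the LOCAL PEELING CONDITIONS at `q`: every pivot row/column is paired
  consistently (mutually inverse tables, same round), its pivot entry is non-zero, rounds are `< 14`,
  a row removed in a row-round `i` has all its other non-zero entries in pivot columns of rounds
  `< i`, and a column removed in a column-round `i` has all its other non-zero entries in pivot rows
  of rounds `< i` (`CwSqGen.rowOkB`, `CwSqGen.colOkB`, with the extraction lemmas `rowOkB_spec`,
  `colOkB_spec`).
* `CwSqGen.goodAt_nine : GoodAt 9` — by `decide +kernel` (`q = 9` has four generic indices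
  `6, 7, 8, 9`, enough to realise every joint shape of a row and a column; the transfer to all
  `q ≥ 5` is `CwSquareGenericTransfer.lean`).

## References

* A. Conner, F. Gesmundo, J. M. Landsberg, E. Ventura, *Rank and border rank of Kronecker powers of
  tensors and Strassen's laser method*, comput. complexity 31 (2022), arXiv:1909.04785, Thm. 1.2,
  §4.3 (the first proof lists, for its `φ₂`, images "modulo the previous ones" — a peeling; here
  the peeling is complete and uniform). [ConnerGesmundoLandsbergVentura2022]
-/

open scoped BigOperators

namespace Literature.Computability.AlgebraicComplexity

namespace CwSqGen

/-! ## Shapes and plumbing -/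

/-- The class of an index: itself if `< 6` (special), `6` if generic. [folklore] -/
def clsNat (x : ℕ) : Fin 7 := if h : x < 6 then ⟨x, by omega⟩ else 6

/-- The equality flag of a pair of indices: both generic and equal. [folklore] -/
def eqFlag (x y : ℕ) : Fin 2 := if 6 ≤ x ∧ x = y then 1 else 0

variable {q : ℕ}

/-- Plumbing: code `p < 6` is the constant index `p`, code `6` copies the first index, code `7`
the second. (For `q < 5` constants are clamped; irrelevant.) [folklore] -/
def plumbApply (p : Fin 8) (x₁ x₂ : Fin (q + 1)) : Fin (q + 1) :=
  if p.val < 6 then ⟨min p.val q, by omega⟩ else if p.val = 6 then x₁ else x₂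

/-- Pivot table for ROWS of shape `(t, class c₁, class c₂, [c₁ = c₂ generic])`: `some (round, isRowRound, s, p₁, p₂)` means the row is a pivot of round `round` (an `R`-round iff `isRowRound`), paired with the column `(s, (plumb p₁, plumb p₂))`; `none` = not a pivot. [cite: ConnerGesmundoLandsbergVentura2022, §4.3] -/
def rowTab : Fin 3 → Fin 7 → Fin 7 → Fin 2 → Option (ℕ × Bool × Fin 3 × Fin 8 × Fin 8) :=
  ![![![![some (1, false, 0, 1, 4), none],
        ![some (8, true, 0, 3, 1), none],
        ![some (6, true, 1, 1, 2), none],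
        ![some (4, true, 0, 3, 3), none],
        ![some (1, false, 0, 3, 4), none],
        ![some (1, false, 0, 3, 5), none],
        ![some (1, false, 0, 3, 7), none]],
      ![![some (1, false, 0, 1, 2), none],
        ![some (6, true, 1, 1, 1), none],
        ![some (9, false, 0, 1, 0), none],
        ![some (2, true, 1, 1, 3), none],
        ![some (3, false, 1, 1, 4), none],
        ![some (3, false, 1, 1, 5), none],
        ![some (3, false, 1, 1, 7), none]],
      ![![some (4, true, 0, 2, 2), none],
        ![some (2, true, 1, 2, 1), none],
        ![some (12, true, 1, 2, 2), none],
        ![some (0, true, 1, 2, 3), none],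
        ![some (0, true, 1, 2, 4), none],
        ![some (0, true, 1, 2, 5), none],
        ![some (0, true, 1, 2, 7), none]],
      ![![some (4, true, 0, 3, 2), none],
        ![some (7, false, 0, 0, 1), none],
        ![some (1, false, 1, 3, 2), none],
        ![some (12, true, 1, 3, 3), none],
        ![some (1, false, 1, 3, 4), none],
        ![some (1, false, 1, 3, 5), none],
        ![some (1, false, 1, 3, 7), none]],
      ![![some (6, true, 0, 4, 2), none],
        ![some (4, true, 1, 4, 1), none],
        ![some (7, false, 0, 4, 0), none],
        ![some (0, true, 1, 4, 3), none],
        ![some (0, true, 1, 4, 4), none],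
        ![some (0, true, 1, 4, 5), none],
        ![some (0, true, 1, 4, 7), none]],
      ![![some (6, true, 0, 5, 2), none],
        ![some (4, true, 1, 5, 1), none],
        ![some (7, false, 0, 5, 0), none],
        ![some (0, true, 1, 5, 3), none],
        ![some (0, true, 1, 5, 4), none],
        ![some (0, true, 1, 5, 5), none],
        ![some (0, true, 1, 5, 7), none]],
      ![![some (6, true, 0, 6, 2), none],
        ![some (4, true, 1, 6, 1), none],
        ![some (7, false, 0, 6, 0), none],
        ![some (0, true, 1, 6, 3), none],
        ![some (0, true, 1, 6, 4), none],
        ![some (0, true, 1, 6, 5), none],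
        ![some (0, true, 1, 6, 7), some (0, true, 1, 6, 6)]]],
    ![![![some (3, false, 0, 4, 4), none],
        ![some (5, false, 0, 4, 1), none],
        ![some (10, true, 0, 2, 0), none],
        ![some (1, false, 0, 4, 3), none],
        ![some (1, false, 0, 5, 4), none],
        ![some (1, false, 0, 4, 5), none],
        ![some (1, false, 0, 4, 7), none]],
      ![![some (1, false, 0, 1, 1), none],
        ![some (7, false, 2, 1, 1), none],
        ![some (7, false, 2, 0, 2), none],
        ![some (3, false, 2, 1, 3), none],
        ![some (2, true, 2, 1, 4), none],
        ![some (2, true, 2, 1, 5), none],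
        ![some (2, true, 2, 1, 7), none]],
      ![![some (1, false, 0, 2, 1), none],
        ![some (3, false, 2, 2, 1), none],
        ![some (13, false, 2, 2, 2), none],
        ![some (0, true, 2, 2, 3), none],
        ![some (0, true, 2, 2, 4), none],
        ![some (0, true, 2, 2, 5), none],
        ![some (0, true, 2, 2, 7), none]],
      ![![some (10, true, 0, 0, 3), none],
        ![some (3, false, 0, 3, 0), none],
        ![some (0, true, 2, 3, 2), none],
        ![some (13, false, 2, 3, 3), none],
        ![some (0, true, 2, 3, 4), none],
        ![some (0, true, 2, 3, 5), none],
        ![some (0, true, 2, 3, 7), none]],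
      ![![some (3, false, 0, 0, 4), none],
        ![some (5, false, 2, 4, 1), none],
        ![some (8, true, 0, 0, 2), none],
        ![some (1, false, 2, 4, 3), none],
        ![some (1, false, 2, 4, 4), none],
        ![some (1, false, 2, 4, 5), none],
        ![some (1, false, 2, 4, 7), none]],
      ![![some (3, false, 0, 0, 5), none],
        ![some (5, false, 2, 5, 1), none],
        ![none, none],
        ![some (1, false, 2, 5, 3), none],
        ![some (1, false, 2, 5, 4), none],
        ![some (1, false, 2, 5, 5), none],
        ![some (1, false, 2, 5, 7), none]],
      ![![some (3, false, 0, 0, 6), none],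
        ![some (5, false, 2, 6, 1), none],
        ![none, none],
        ![some (1, false, 2, 6, 3), none],
        ![some (1, false, 2, 6, 4), none],
        ![some (1, false, 2, 6, 5), none],
        ![some (1, false, 2, 6, 7), some (1, false, 2, 6, 6)]]],
    ![![![none, none],
        ![some (6, true, 2, 3, 1), none],
        ![some (9, false, 1, 4, 2), none],
        ![some (11, false, 1, 3, 0), none],
        ![some (2, true, 1, 4, 0), none],
        ![some (2, true, 1, 5, 0), none],
        ![some (2, true, 1, 7, 0), none]],
      ![![some (8, true, 2, 1, 2), none],
        ![some (0, true, 1, 1, 0), none],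
        ![some (0, true, 2, 1, 0), none],
        ![none, none],
        ![some (0, true, 2, 0, 0), none],
        ![none, none],
        ![none, none]],
      ![![some (11, false, 1, 0, 2), none],
        ![some (0, true, 1, 2, 0), none],
        ![some (4, true, 2, 2, 0), none],
        ![none, none],
        ![none, none],
        ![none, none],
        ![none, none]],
      ![![some (2, true, 1, 3, 1), none],
        ![some (9, false, 2, 0, 1), none],
        ![some (5, false, 2, 3, 0), none],
        ![some (4, true, 2, 0, 3), none],
        ![some (0, true, 2, 0, 4), none],
        ![some (0, true, 2, 0, 5), none],
        ![some (0, true, 2, 0, 7), none]],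
      ![![some (6, true, 2, 4, 2), none],
        ![some (4, true, 1, 0, 1), none],
        ![some (7, false, 2, 4, 0), none],
        ![some (0, true, 1, 0, 3), none],
        ![some (2, true, 1, 0, 0), none],
        ![some (0, true, 1, 0, 5), none],
        ![some (0, true, 1, 0, 7), none]],
      ![![some (6, true, 2, 5, 2), none],
        ![none, none],
        ![some (7, false, 2, 5, 0), none],
        ![none, none],
        ![some (0, true, 1, 0, 4), none],
        ![none, none],
        ![none, none]],
      ![![some (6, true, 2, 6, 2), none],
        ![none, none],
        ![some (7, false, 2, 6, 0), none],
        ![none, none],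
        ![none, none],
        ![none, none],
        ![none, none]]]]

/-- Pivot table for COLUMNS of shape `(s, class b₁, class b₂, [b₁ = b₂ generic])`: `some (round, isRowRound, t, p₁, p₂)` means the column is a pivot of round `round`, paired with the row `(t, (plumb p₁, plumb p₂))`. [cite: ConnerGesmundoLandsbergVentura2022, §4.3] -/
def colTab : Fin 3 → Fin 7 → Fin 7 → Fin 2 → Option (ℕ × Bool × Fin 3 × Fin 8 × Fin 8) :=
  ![![![![none, none],
        ![some (7, false, 0, 3, 1), none],
        ![some (8, true, 1, 4, 2), none],
        ![some (10, true, 1, 3, 0), none],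
        ![some (3, false, 1, 4, 0), none],
        ![some (3, false, 1, 5, 0), none],
        ![some (3, false, 1, 7, 0), none]],
      ![![some (9, false, 0, 1, 2), none],
        ![some (1, false, 1, 1, 0), none],
        ![some (1, false, 0, 1, 0), none],
        ![none, none],
        ![some (1, false, 0, 0, 0), none],
        ![none, none],
        ![none, none]],
      ![![some (10, true, 1, 0, 2), none],
        ![some (1, false, 1, 2, 0), none],
        ![some (4, true, 0, 2, 0), none],
        ![none, none],
        ![none, none],
        ![none, none],
        ![none, none]],
      ![![some (3, false, 1, 3, 1), none],
        ![some (8, true, 0, 0, 1), none],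
        ![some (4, true, 0, 3, 0), none],
        ![some (4, true, 0, 0, 3), none],
        ![some (1, false, 0, 0, 4), none],
        ![some (1, false, 0, 0, 5), none],
        ![some (1, false, 0, 0, 7), none]],
      ![![some (7, false, 0, 4, 2), none],
        ![some (5, false, 1, 0, 1), none],
        ![some (6, true, 0, 4, 0), none],
        ![some (1, false, 1, 0, 3), none],
        ![some (3, false, 1, 0, 0), none],
        ![some (1, false, 1, 0, 5), none],
        ![some (1, false, 1, 0, 7), none]],
      ![![some (7, false, 0, 5, 2), none],
        ![none, none],
        ![some (6, true, 0, 5, 0), none],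
        ![none, none],
        ![some (1, false, 1, 0, 4), none],
        ![none, none],
        ![none, none]],
      ![![some (7, false, 0, 6, 2), none],
        ![none, none],
        ![some (6, true, 0, 6, 0), none],
        ![none, none],
        ![none, none],
        ![none, none],
        ![none, none]]],
    ![![![some (2, true, 2, 4, 4), none],
        ![some (4, true, 2, 4, 1), none],
        ![some (11, false, 2, 2, 0), none],
        ![some (0, true, 2, 4, 3), none],
        ![some (0, true, 2, 5, 4), none],
        ![some (0, true, 2, 4, 5), none],
        ![some (0, true, 2, 4, 7), none]],
      ![![some (0, true, 2, 1, 1), none],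
        ![some (6, true, 0, 1, 1), none],
        ![some (6, true, 0, 0, 2), none],
        ![some (2, true, 0, 1, 3), none],
        ![some (3, false, 0, 1, 4), none],
        ![some (3, false, 0, 1, 5), none],
        ![some (3, false, 0, 1, 7), none]],
      ![![some (0, true, 2, 2, 1), none],
        ![some (2, true, 0, 2, 1), none],
        ![some (12, true, 0, 2, 2), none],
        ![some (0, true, 0, 2, 3), none],
        ![some (0, true, 0, 2, 4), none],
        ![some (0, true, 0, 2, 5), none],
        ![some (0, true, 0, 2, 7), none]],
      ![![some (11, false, 2, 0, 3), none],
        ![some (2, true, 2, 3, 0), none],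
        ![some (1, false, 0, 3, 2), none],
        ![some (12, true, 0, 3, 3), none],
        ![some (1, false, 0, 3, 4), none],
        ![some (1, false, 0, 3, 5), none],
        ![some (1, false, 0, 3, 7), none]],
      ![![some (2, true, 2, 0, 4), none],
        ![some (4, true, 0, 4, 1), none],
        ![some (9, false, 2, 0, 2), none],
        ![some (0, true, 0, 4, 3), none],
        ![some (0, true, 0, 4, 4), none],
        ![some (0, true, 0, 4, 5), none],
        ![some (0, true, 0, 4, 7), none]],
      ![![some (2, true, 2, 0, 5), none],
        ![some (4, true, 0, 5, 1), none],
        ![none, none],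
        ![some (0, true, 0, 5, 3), none],
        ![some (0, true, 0, 5, 4), none],
        ![some (0, true, 0, 5, 5), none],
        ![some (0, true, 0, 5, 7), none]],
      ![![some (2, true, 2, 0, 6), none],
        ![some (4, true, 0, 6, 1), none],
        ![none, none],
        ![some (0, true, 0, 6, 3), none],
        ![some (0, true, 0, 6, 4), none],
        ![some (0, true, 0, 6, 5), none],
        ![some (0, true, 0, 6, 7), some (0, true, 0, 6, 6)]]],
    ![![![some (0, true, 2, 1, 4), none],
        ![some (9, false, 2, 3, 1), none],
        ![some (7, false, 1, 1, 2), none],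
        ![some (4, true, 2, 3, 3), none],
        ![some (0, true, 2, 3, 4), none],
        ![some (0, true, 2, 3, 5), none],
        ![some (0, true, 2, 3, 7), none]],
      ![![some (0, true, 2, 1, 2), none],
        ![some (7, false, 1, 1, 1), none],
        ![some (8, true, 2, 1, 0), none],
        ![some (3, false, 1, 1, 3), none],
        ![some (2, true, 1, 1, 4), none],
        ![some (2, true, 1, 1, 5), none],
        ![some (2, true, 1, 1, 7), none]],
      ![![some (4, true, 2, 2, 2), none],
        ![some (3, false, 1, 2, 1), none],
        ![some (13, false, 1, 2, 2), none],
        ![some (0, true, 1, 2, 3), none],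
        ![some (0, true, 1, 2, 4), none],
        ![some (0, true, 1, 2, 5), none],
        ![some (0, true, 1, 2, 7), none]],
      ![![some (5, false, 2, 3, 2), none],
        ![some (6, true, 2, 0, 1), none],
        ![some (0, true, 1, 3, 2), none],
        ![some (13, false, 1, 3, 3), none],
        ![some (0, true, 1, 3, 4), none],
        ![some (0, true, 1, 3, 5), none],
        ![some (0, true, 1, 3, 7), none]],
      ![![some (7, false, 2, 4, 2), none],
        ![some (5, false, 1, 4, 1), none],
        ![some (6, true, 2, 4, 0), none],
        ![some (1, false, 1, 4, 3), none],
        ![some (1, false, 1, 4, 4), none],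
        ![some (1, false, 1, 4, 5), none],
        ![some (1, false, 1, 4, 7), none]],
      ![![some (7, false, 2, 5, 2), none],
        ![some (5, false, 1, 5, 1), none],
        ![some (6, true, 2, 5, 0), none],
        ![some (1, false, 1, 5, 3), none],
        ![some (1, false, 1, 5, 4), none],
        ![some (1, false, 1, 5, 5), none],
        ![some (1, false, 1, 5, 7), none]],
      ![![some (7, false, 2, 6, 2), none],
        ![some (5, false, 1, 6, 1), none],
        ![some (6, true, 2, 6, 0), none],
        ![some (1, false, 1, 6, 3), none],
        ![some (1, false, 1, 6, 4), none],
        ![some (1, false, 1, 6, 5), none],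
        ![some (1, false, 1, 6, 7), some (1, false, 1, 6, 6)]]]]

/-- The pivot data of a row at level `q`: round, kind, partner column. [folklore] -/
def rowInfo (r : Row q) : Option (ℕ × Bool × Col q) :=
  match rowTab r.1 (clsNat r.2.1.val) (clsNat r.2.2.val) (eqFlag r.2.1.val r.2.2.val) with
  | none => none
  | some (i, k, s, p₁, p₂) => some (i, k, (s, (plumbApply p₁ r.2.1 r.2.2, plumbApply p₂ r.2.1 r.2.2)))

/-- The pivot data of a column at level `q`: round, kind, partner row. [folklore] -/
def colInfo (c : Col q) : Option (ℕ × Bool × Row q) :=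
  match colTab c.1 (clsNat c.2.1.val) (clsNat c.2.2.val) (eqFlag c.2.1.val c.2.2.val) with
  | none => none
  | some (i, k, t, p₁, p₂) => some (i, k, (t, (plumbApply p₁ c.2.1 c.2.2, plumbApply p₂ c.2.1 c.2.2)))

/-! ## The local peeling conditions -/

/-- `colRoundLt c i`: the column `c` is a pivot column of some round `< i`. [folklore] -/
def colRoundLt (q : ℕ) (c : Col q) (i : ℕ) : Bool :=
  match colInfo c with
  | some (i', _, _) => decide (i' < i)
  | none => false

/-- `rowRoundLt r i`: the row `r` is a pivot row of some round `< i`. [folklore] -/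
def rowRoundLt (q : ℕ) (r : Row q) (i : ℕ) : Bool :=
  match rowInfo r with
  | some (i', _, _) => decide (i' < i)
  | none => false

/-- The row condition: if `r` is a pivot row (round `i`, kind `k`, partner `pc`), then the tables are
mutually inverse at `(r, pc)`, the pivot entry is non-zero, `i < 14`, and — if `i` is a row-round —
every other non-zero entry of the row lies in a pivot column of an earlier round. [folklore] -/
def rowOkB (q : ℕ) (r : Row q) : Bool :=
  match rowInfo r with
  | none => true
  | some (i, k, pc) =>
      decide (colInfo pc = some (i, k, r)) && decide (kgen q r pc ≠ 0) && decide (i < 14) &&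
        (!k || decide (∀ c : Col q, kgen q r c ≠ 0 → c = pc ∨ colRoundLt q c i = true))

/-- The column condition (dual to `rowOkB`, for column-rounds). [folklore] -/
def colOkB (q : ℕ) (c : Col q) : Bool :=
  match colInfo c with
  | none => true
  | some (i, k, pr) =>
      decide (rowInfo pr = some (i, k, c)) && decide (i < 14) &&
        (k || decide (∀ r : Row q, kgen q r c ≠ 0 → r = pr ∨ rowRoundLt q r i = true))

/-- **The local peeling conditions at level `q`.** [folklore] -/
def GoodAt (q : ℕ) : Prop :=
  (∀ r : Row q, rowOkB q r = true) ∧ (∀ c : Col q, colOkB q c = true)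

/-- What `rowOkB r = true` says about a pivot row. [folklore] -/
theorem rowOkB_spec {r : Row q} (h : rowOkB q r = true) {i : ℕ} {k : Bool} {pc : Col q}
    (hr : rowInfo r = some (i, k, pc)) :
    colInfo pc = some (i, k, r) ∧ kgen q r pc ≠ 0 ∧ i < 14 ∧
      (k = true → ∀ c : Col q, kgen q r c ≠ 0 → c = pc ∨ colRoundLt q c i = true) := by
  unfold rowOkB at h
  rw [hr] at h
  simp only [Bool.and_eq_true, decide_eq_true_eq, Bool.or_eq_true, Bool.not_eq_true'] at h
  obtain ⟨⟨⟨h1, h2⟩, h3⟩, h4⟩ := h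
  refine ⟨h1, h2, h3, fun hk => ?_⟩
  rcases h4 with h4 | h4
  · rw [hk] at h4
    exact absurd h4 (by decide)
  · exact h4

/-- What `colOkB c = true` says about a pivot column. [folklore] -/
theorem colOkB_spec {c : Col q} (h : colOkB q c = true) {i : ℕ} {k : Bool} {pr : Row q}
    (hc : colInfo c = some (i, k, pr)) :
    rowInfo pr = some (i, k, c) ∧ i < 14 ∧
      (k = false → ∀ r : Row q, kgen q r c ≠ 0 → r = pr ∨ rowRoundLt q r i = true) := by
  unfold colOkB at h
  rw [hc] at h
  simp only [Bool.and_eq_true, decide_eq_true_eq, Bool.or_eq_true] at h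
  obtain ⟨⟨h1, h2⟩, h3⟩ := h
  refine ⟨h1, h2, fun hk => ?_⟩
  rcases h3 with h3 | h3
  · rw [hk] at h3
    exact absurd h3 (by decide)
  · exact h3

/-! ## Verification at `q = 9` -/

-- The two `decide +kernel` below evaluate ~10⁵ entries of the `300 × 300` flattening in the kernel
-- (about two minutes); the default heartbeat budget does not suffice.
set_option maxHeartbeats 0 in
/-- **The peeling conditions hold at `q = 9`** (kernel computation over the `300 × 300` flattening).
[cite: ConnerGesmundoLandsbergVentura2022, §4.3] -/
theorem goodAt_nine : GoodAt 9 :=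
  ⟨by decide +kernel, by decide +kernel⟩

end CwSqGen

end Literature.Computability.AlgebraicComplexity
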